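import Summits.QuantumFields.BalabanUV.T4Continuum.Support.NE7HessGaugeDirLeft
import Summits.QuantumFields.BalabanUV.T4Continuum.Support.NE3FramePotBoundW
import Summits.QuantumFields.BalabanUV.T4Continuum.Support.NE3CurlOfGaugeDir
import HarnessLib

/-!
# NE7SliceLetterGaugeObstruction — THE CURVED SLICE-SOLVER LETTER (L2) AS TYPED IS UNSATISFIABLE OFF THE FLAT ORBIT: at every background `W` of the multi-level class that
# is critical on ALL skew periodic directions, the hypothesis `hG` of F55 … F123d (with `hS : S ⊇ {W-tangent skew periodic fields}`) FAILS FOR EVERY CONSTANT `K_G` as soon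
# as ONE plaquette `hol_W(∂p)` at a non-corner site fails to commute with ONE skew matrix — witnessed by the tangent gauge mode of a periodised single-site bump, whose
# slice Hessian functional vanishes identically (F127) while its dressed curl is the plaquette commutator `ζ − Ad_{hol}ζ ≠ 0` (file 58 of the curved (APE))

Cell `pub-balaban`, rung (B)+1 sub-cell t4, lineage `b2b-balaban-t4-ne7-p1` (CRUX PROVER NE7 #1 = OWNER of row NE7), generation 80; memo
`t4/b2b-balaban-t4-ne7-p1-g80/SLICE-LETTER-OBSTRUCTION.md` §2.  File F128, over F127 `NE7HessGaugeDirLeft.hess_gaugeDir_left_eq_zero_of_critical`, row NE3's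
`NE3TangentCovariantTower.dirIter_gaugeDir` («gauge directions stay gauge directions through the whole tower, exactly»), `NE3CurlOfGaugeDir.curlAt_gaugeDir`
(`curl_W(gaugeDir W ζ)(p) = ζ − Ad_{hol_W(∂p)}ζ`), `NE7ExactCurrent.isSkewDir_gaugeDir`, `BlockAveragePushDirGauge.isPeriodicDir_gaugeDir`.

THE POINT.  The letter (L2) of the curved (APE) — `hG : ∀ X ∈ S` periodic `W`-tangent, `∀ g ≥ 0`, `(∀ Y` skew periodic `W`-tangent, `|hess W X Y| ≤ g‖Y‖_{ℓ¹}) →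
∀ z μ ν, μ ≠ ν → ‖curlAt W X z μ ν‖ ≤ K_G·g`, with `hS : S ⊇ {W-tangent skew periodic}` (F112 … F123d) — is TRUE at the flat background (lineage #2's (152), F124) because
there the residual gauge modes `X = gaugeDir 1 ξ`, `ξ` vanishing on the corner lattice `L^{j+1}ℤ^d`, have zero Hessian functional AND zero curl.  At a CURVED background the
first survives (the Hessian of a gauge mode is a first variation in a commutator direction, F107∕F127 — zero at a critical point) but the second does not: `curl_W(gaugeDir W ξ)(p)
= ξ(z) − Ad_{hol_W(∂p)}ξ(z)` is of the order of the background's plaquette radius.  So with `g = 0` the letter demands `ξ(z) = Ad_{hol_W(∂p)}ξ(z)` for every tangent `ξ` —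
false whenever some plaquette at a non-corner site is not in the commutant of `𝔲(N)`, i.e. (for `N ≥ 2`) whenever `W` is not locally central-flux.  The global criticality
hypothesis is met by every NON-FLAT critical point of the Wilson action in the class — e.g. the constant abelian flux backgrounds on the torus (successor file F129
`NE7SliceLetterConstantFluxWitness`), which are unitary, periodic, small-field for large `N`, tangent-critical and have zero flux gradient: admissible data of F123d at which its
hypothesis `hG` is unsatisfiable, so the END is VACUOUS there.  At a tangent-critical `W` that is NOT globally critical the same mode has Hessian functional `O(‖δ_W F_W‖·‖ξ‖·‖Y‖₁)`
(F127 §4), still not commensurate with its curl: no level-uniform `K_G` exists off the flat orbit.  REPAIR (memo §3, F130): the conclusion of (L2) must carry a second,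
`g`-independent term — `‖curlAt W X‖ ≤ K_G·g + E_G` with `E_G` an allowance for the gauge content of `S` (this file's §3: necessarily `E_G ≥ ‖ζ − Ad_{hol}ζ‖`) — or `S` must
exclude the residual gauge modes (Landau slice), which the consumer's field `Z′ − A_N` (road (B)) does not satisfy.
WHAT ([folklore]; 0 def, 0 sorry).  §1 `dirIter_gaugeDir_eq_zero_of_vanish_corners` (gauge modes vanishing on the corner lattice are `W`-tangent, exactly); §2 the periodised
single-site bump (equational hypothesis `hξ : ∀ y, ξ y = if (∀ i, P ∣ y i − x₀ i) then ζ else 0`): skew, periodic, SPARSE for `P ≥ 2`, vanishing on the corners when `x₀` is off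
the corner lattice, `ξ x₀ = ζ`; §3 **`sliceLetter_false_of_critical`** (F123d's binders `hS`, `hG` verbatim ⟹ `False`), `not_sliceLetter_of_critical` (no `K_G` validates the bare
letter), `twoTerm_allowance_ge` (any valid two-term letter has `E_G ≥ ‖ζ − Ad_{hol_W(∂p)}ζ‖`).
HONEST FRAMING (page 1): a NEGATIVE bookkeeping result about OUR letter (L2) as typed; it asserts nothing of Bałaban's (his fluctuation propagator acts on GAUGE-FIXED fields,
[Balaban1985PropagatorsII]∕[Balaban1985RegularSpaces] (1.38) — the tree's `IsLandauB8`); the flat (152) is untouched; NOT ONE-STEP, NOT NE7; spine 0∕9; finite T⁴ rung (B)+1 —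
NOT infinite volume, NOT mass gap, NOT `BetaPertH`, NOT Clay.  Continuum YM on T⁴ ⇐ BetaPertH ∧ nine spine estimates (0/9 proved); BetaPertH ⇐ (D1) ∧ (D4) ∧ CAP+tail;
G-an2-4 gates asym, D1 and NE2/3/4.
-/

set_option autoImplicit false

open scoped BigOperators Matrix.Norms.L2Operator
open NormedSpace Finset

namespace Summit.QuantumFields.BalabanUV.T4Continuum.NE7SliceLetterGaugeObstruction

open Literature.MathematicalPhysics.QuantumFieldTheory.Balaban1983to89
open B7Prop1Explicit B7Prop2Explicit UnitaryModel
open T4AveragingDeficitWall (Ad IsUnitaryCfg IsSkewDir SmallField vary curlAt dirL1)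
open T4AveragingDeficitWallBoundary (IsPeriodicCfg periodBox)
open AveragingDeficitPeriodicCounting (IsPeriodicDir)
open AveragingDeficitMultiLevelPrep (cavgIter LevelSmall tower)
open MinimalActionLevels (perWin)
open BlockAveragePushDirGauge (gaugeDir isPeriodicDir_gaugeDir)
open NE3HessForm (hess dAction)
open NE3TangentCovariantTower (dirIter dirIter_gaugeDir)
open NE3FramePotBoundW (tower_eq_pow_mul)
open NE3CurlOfGaugeDir (curlAt_gaugeDir)
open NE7ExactCurrent (isSkewDir_gaugeDir)
open NE7HessGaugeDirLeft (hess_gaugeDir_left_eq_zero_of_critical)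
open AveragingDeficitNearIdentity (Ad_zero)

noncomputable section

variable {d : ℕ} {n : Type*} [Fintype n] [DecidableEq n]

/-! ## §1 Gauge modes vanishing on the corner lattice are tangent to the slice, exactly -/

/-- **RESIDUAL GAUGE MODES ARE `W`-TANGENT**: for a unitary `(N·L^{j+1})`-periodic `W` of the multi-level class and a skew `(N·L^{j+1})`-periodic generator `ξ` VANISHING ON THE
CORNER LATTICE `L^{j+1}ℤ^d`, `dirIter L (j+1) W (gaugeDir W ξ) = 0` (row NE3's `dirIter_gaugeDir`: the linearised tower maps `gaugeDir W ξ` to the coarse gauge direction of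
`ξ∘(L^{j+1}•)`, which is `0`). [folklore] -/
theorem dirIter_gaugeDir_eq_zero_of_vanish_corners [Nonempty n] {L N : ℕ} [NeZero N] (hL : 1 ≤ L) (j : ℕ)
    {W : Site d → Fin d → (Matrix n n ℂ)ˣ} {x : ℝ} (hWu : IsUnitaryCfg W) (hWP : IsPeriodicCfg W ((N * L ^ (j + 1) : ℕ) : ℤ))
    (hx : 0 ≤ x) (hs : LevelSmall d L j x) (hWx : SmallField W x)
    {ξ : Site d → Matrix n n ℂ} (hξs : ∀ y, ξ y ∈ skewAdjoint (Matrix n n ℂ))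
    (hξP : ∀ (y : Site d) (i : Fin d), ξ (y + ((N * L ^ (j + 1) : ℕ) : ℤ) • e i) = ξ y)
    (hξc : ∀ y : Site d, ξ (((L : ℤ) ^ (j + 1)) • y) = 0) :
    dirIter L (j + 1) W (gaugeDir W ξ) = 0 := by
  have hT : tower L N (j + 1) = N * L ^ (j + 1) := by rw [tower_eq_pow_mul, Nat.mul_comm]
  have hWPt : IsPeriodicCfg W ((tower L N (j + 1) : ℕ) : ℤ) := by rw [hT]; exact hWP
  have hξPt : ∀ (y : Site d) (i : Fin d), ξ (y + ((tower L N (j + 1) : ℕ) : ℤ) • e i) = ξ y := by rw [hT]; exact hξP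
  rw [dirIter_gaugeDir (M := N) hL j hWu hWPt hx hs hWx hξs hξPt]
  funext z κ
  simp only [gaugeDir, hξc, Ad_zero, sub_zero, Pi.zero_apply]

/-! ## §2 The periodised single-site bump -/

section Bump

variable {P : ℕ} {x₀ : Site d} {ζ : Matrix n n ℂ} {ξ : Site d → Matrix n n ℂ}

omit [Fintype n] [DecidableEq n] in
/-- The bump takes the value `ζ` at its centre. [folklore] -/
theorem bump_centre (hξ : ∀ y : Site d, ξ y = if (∀ i : Fin d, (P : ℤ) ∣ y i - x₀ i) then ζ else 0) : ξ x₀ = ζ := by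
  rw [hξ, if_pos fun i => by simp]

omit [Fintype n] [DecidableEq n] in
/-- The bump is skew when `ζ` is. [folklore] -/
theorem bump_skew (hξ : ∀ y : Site d, ξ y = if (∀ i : Fin d, (P : ℤ) ∣ y i - x₀ i) then ζ else 0) (hζ : ζ ∈ skewAdjoint (Matrix n n ℂ)) :
    ∀ y, ξ y ∈ skewAdjoint (Matrix n n ℂ) := by
  intro y
  rw [hξ]
  split_ifs
  · exact hζ
  · exact (skewAdjoint (Matrix n n ℂ)).zero_mem

omit [Fintype n] [DecidableEq n] in
/-- The bump is `P`-periodic. [folklore] -/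
theorem bump_periodic (hξ : ∀ y : Site d, ξ y = if (∀ i : Fin d, (P : ℤ) ∣ y i - x₀ i) then ζ else 0) :
    ∀ (y : Site d) (i : Fin d), ξ (y + (P : ℤ) • e i) = ξ y := by
  intro y i
  rw [hξ, hξ y]
  have hiff : (∀ k : Fin d, (P : ℤ) ∣ (y + (P : ℤ) • e i) k - x₀ k) ↔ ∀ k : Fin d, (P : ℤ) ∣ y k - x₀ k := by
    refine forall_congr' fun k => ?_
    have hk : (y + (P : ℤ) • e i) k - x₀ k = (y k - x₀ k) + (P : ℤ) * (e i : Site d) k := by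
      simp only [Pi.add_apply, Pi.smul_apply, smul_eq_mul]; ring
    rw [hk]
    exact dvd_add_left (dvd_mul_right _ _)
  simp only [hiff]

omit [Fintype n] [DecidableEq n] in
/-- **THE BUMP IS SPARSE** for `P ≥ 2`: no bond carries it at both ends. [folklore] -/
theorem bump_sparse (hξ : ∀ y : Site d, ξ y = if (∀ i : Fin d, (P : ℤ) ∣ y i - x₀ i) then ζ else 0) (hP : 2 ≤ P) :
    ∀ (y : Site d) (κ : Fin d), ξ y = 0 ∨ ξ (y + e κ) = 0 := by
  intro y κ
  by_cases h1 : ∀ i : Fin d, (P : ℤ) ∣ y i - x₀ i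
  · right
    rw [hξ, if_neg]
    intro h2
    have ha := h1 κ
    have hb := h2 κ
    have hb' : (y + e κ) κ - x₀ κ = (y κ - x₀ κ) + 1 := by
      simp only [Pi.add_apply, B7Prop1Explicit.e, Pi.single_eq_same]; ring
    rw [hb'] at hb
    have h1dvd : (P : ℤ) ∣ 1 := by simpa using hb.sub ha
    have hP1 : (P : ℤ) ≤ 1 := Int.le_of_dvd one_pos h1dvd
    omega
  · left
    rw [hξ, if_neg h1]

omit [Fintype n] [DecidableEq n] in
/-- **THE BUMP VANISHES ON THE CORNER LATTICE** `Mℤ^d` when `M ∣ P` and the centre `x₀` is OFF that lattice (`¬ M ∣ x₀ i₀` for some `i₀`). [folklore] -/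
theorem bump_vanish_corners (hξ : ∀ y : Site d, ξ y = if (∀ i : Fin d, (P : ℤ) ∣ y i - x₀ i) then ζ else 0) {M : ℤ} (hMP : M ∣ (P : ℤ))
    {i₀ : Fin d} (hx₀ : ¬ M ∣ x₀ i₀) : ∀ y : Site d, ξ (M • y) = 0 := by
  intro y
  rw [hξ, if_neg]
  intro h
  apply hx₀
  have h1 : (P : ℤ) ∣ (M • y) i₀ - x₀ i₀ := h i₀
  have h2 : M ∣ (M • y) i₀ - x₀ i₀ := hMP.trans h1
  have h3 : M ∣ (M • y) i₀ := by simp only [Pi.smul_apply, smul_eq_mul]; exact dvd_mul_right M _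
  simpa using h3.sub h2

end Bump

/-! ## §3 The obstruction -/

/-- **THE CURVED (L2) LETTER AS TYPED IS UNSATISFIABLE AT A GLOBALLY CRITICAL BACKGROUND WITH A NON-COMMUTING PLAQUETTE** (F123d's binders `hS`, `hG` VERBATIM ⟹ `False`).
Data: `L ≥ 1`, `N ≥ 1`, `j`; `W` unitary `(N·L^{j+1})`-periodic of the multi-level class (`LevelSmall d L j x`, `SmallField W x`), CRITICAL ON EVERY SKEW PERIODIC DIRECTION;
a skew periodic SPARSE generator `ξ` vanishing on the corner lattice `L^{j+1}ℤ^d`; a plaquette `(z₀; μ₀ ≠ ν₀)` with `ξ(z₀) ≠ Ad_{hol_W(∂p)}ξ(z₀)`.  Then no set `S` containing the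
`W`-tangent skew periodic fields and no constant `K_G` satisfy `hG`.  Proof: `X := gaugeDir W ξ ∈ S` is tangent (§1), its slice Hessian functional vanishes (F127, `g = 0`), so
`hG` forces `curl_W X(z₀;μ₀,ν₀) = ξ(z₀) − Ad_{hol}ξ(z₀) = 0`. [folklore] -/
theorem sliceLetter_false_of_critical [Nonempty n] {L N : ℕ} [NeZero N] (hL : 1 ≤ L) (j : ℕ)
    {W : Site d → Fin d → (Matrix n n ℂ)ˣ} {x : ℝ} (hWu : IsUnitaryCfg W) (hWP : IsPeriodicCfg W ((N * L ^ (j + 1) : ℕ) : ℤ))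
    (hx : 0 ≤ x) (hs : LevelSmall d L j x) (hWx : SmallField W x)
    (hcritAll : ∀ Y : Site d → Fin d → Matrix n n ℂ, IsSkewDir Y → IsPeriodicDir Y ((N * L ^ (j + 1) : ℕ) : ℤ) →
      dAction W Y (perWin d (N * L ^ (j + 1))) = 0)
    {ξ : Site d → Matrix n n ℂ} (hξs : ∀ y, ξ y ∈ skewAdjoint (Matrix n n ℂ))
    (hξP : ∀ (y : Site d) (i : Fin d), ξ (y + ((N * L ^ (j + 1) : ℕ) : ℤ) • e i) = ξ y)
    (hξsp : ∀ (y : Site d) (κ : Fin d), ξ y = 0 ∨ ξ (y + e κ) = 0)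
    (hξc : ∀ y : Site d, ξ (((L : ℤ) ^ (j + 1)) • y) = 0)
    {z₀ : Site d} {μ₀ ν₀ : Fin d} (hμν : μ₀ ≠ ν₀)
    (hne : ξ z₀ - Ad (hol W z₀ (plaqWord μ₀ ν₀)) (ξ z₀) ≠ 0)
    (S : Set (Site d → Fin d → Matrix n n ℂ))
    (hS : ∀ X : Site d → Fin d → Matrix n n ℂ, IsSkewDir X → IsPeriodicDir X ((N * L ^ (j + 1) : ℕ) : ℤ) → dirIter L (j + 1) W X = 0 → X ∈ S)
    {KG : ℝ}
    (hG : ∀ X ∈ S, IsPeriodicDir X ((N * L ^ (j + 1) : ℕ) : ℤ) → dirIter L (j + 1) W X = 0 → ∀ g : ℝ, 0 ≤ g →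
      (∀ Y : Site d → Fin d → Matrix n n ℂ, IsSkewDir Y → IsPeriodicDir Y ((N * L ^ (j + 1) : ℕ) : ℤ) → dirIter L (j + 1) W Y = 0 →
        |hess W X Y (perWin d (N * L ^ (j + 1)))| ≤ g * dirL1 Y (periodBox (d := d) (N * L ^ (j + 1)))) →
      ∀ z μ' ν', μ' ≠ ν' → ‖curlAt W X z μ' ν'‖ ≤ KG * g) : False := by
  set X : Site d → Fin d → Matrix n n ℂ := gaugeDir W ξ with hX
  have hXs : IsSkewDir X := isSkewDir_gaugeDir hWu hξs
  have hXP : IsPeriodicDir X ((N * L ^ (j + 1) : ℕ) : ℤ) := isPeriodicDir_gaugeDir hWP hξP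
  have hXT : dirIter L (j + 1) W X = 0 := dirIter_gaugeDir_eq_zero_of_vanish_corners hL j hWu hWP hx hs hWx hξs hξP hξc
  have h0 : ∀ Y : Site d → Fin d → Matrix n n ℂ, IsSkewDir Y → IsPeriodicDir Y ((N * L ^ (j + 1) : ℕ) : ℤ) → dirIter L (j + 1) W Y = 0 →
      |hess W X Y (perWin d (N * L ^ (j + 1)))| ≤ 0 * dirL1 Y (periodBox (d := d) (N * L ^ (j + 1))) := by
    intro Y hY hYP _
    rw [hX, hess_gaugeDir_left_eq_zero_of_critical W hcritAll hξs hξP hξsp hY hYP, abs_zero, zero_mul]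
  have hc := hG X (hS X hXs hXP hXT) hXP hXT 0 le_rfl h0 z₀ μ₀ ν₀ hμν
  rw [mul_zero] at hc
  have hzero : curlAt W X z₀ μ₀ ν₀ = 0 := norm_le_zero_iff.mp hc
  rw [hX, curlAt_gaugeDir] at hzero
  exact hne hzero

/-- **NO CONSTANT VALIDATES THE BARE LETTER** (the `S`-free schema over all `W`-tangent skew periodic `X`), same data. [folklore] -/
theorem not_sliceLetter_of_critical [Nonempty n] {L N : ℕ} [NeZero N] (hL : 1 ≤ L) (j : ℕ)
    {W : Site d → Fin d → (Matrix n n ℂ)ˣ} {x : ℝ} (hWu : IsUnitaryCfg W) (hWP : IsPeriodicCfg W ((N * L ^ (j + 1) : ℕ) : ℤ))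
    (hx : 0 ≤ x) (hs : LevelSmall d L j x) (hWx : SmallField W x)
    (hcritAll : ∀ Y : Site d → Fin d → Matrix n n ℂ, IsSkewDir Y → IsPeriodicDir Y ((N * L ^ (j + 1) : ℕ) : ℤ) →
      dAction W Y (perWin d (N * L ^ (j + 1))) = 0)
    {ξ : Site d → Matrix n n ℂ} (hξs : ∀ y, ξ y ∈ skewAdjoint (Matrix n n ℂ))
    (hξP : ∀ (y : Site d) (i : Fin d), ξ (y + ((N * L ^ (j + 1) : ℕ) : ℤ) • e i) = ξ y)
    (hξsp : ∀ (y : Site d) (κ : Fin d), ξ y = 0 ∨ ξ (y + e κ) = 0)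
    (hξc : ∀ y : Site d, ξ (((L : ℤ) ^ (j + 1)) • y) = 0)
    {z₀ : Site d} {μ₀ ν₀ : Fin d} (hμν : μ₀ ≠ ν₀)
    (hne : ξ z₀ - Ad (hol W z₀ (plaqWord μ₀ ν₀)) (ξ z₀) ≠ 0) (KG : ℝ) :
    ¬ (∀ X : Site d → Fin d → Matrix n n ℂ, IsSkewDir X → IsPeriodicDir X ((N * L ^ (j + 1) : ℕ) : ℤ) → dirIter L (j + 1) W X = 0 → ∀ g : ℝ, 0 ≤ g →
      (∀ Y : Site d → Fin d → Matrix n n ℂ, IsSkewDir Y → IsPeriodicDir Y ((N * L ^ (j + 1) : ℕ) : ℤ) → dirIter L (j + 1) W Y = 0 →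
        |hess W X Y (perWin d (N * L ^ (j + 1)))| ≤ g * dirL1 Y (periodBox (d := d) (N * L ^ (j + 1)))) →
      ∀ z μ' ν', μ' ≠ ν' → ‖curlAt W X z μ' ν'‖ ≤ KG * g) := by
  intro hG
  exact sliceLetter_false_of_critical hL j hWu hWP hx hs hWx hcritAll hξs hξP hξsp hξc hμν hne
    {X : Site d → Fin d → Matrix n n ℂ | IsSkewDir X} (fun X hX _ _ => hX) (KG := KG)
    (fun X hX hXP hXT g hg hH => hG X hX hXP hXT g hg hH)

/-- **THE TWO-TERM LETTER's ALLOWANCE IS BOUNDED BELOW BY THE PLAQUETTE COMMUTATOR**: if a two-term letter `‖curlAt W X z μ ν‖ ≤ K_G·g + E_G` holds on a set `S` containing the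
`W`-tangent skew periodic fields (same data as above), then `‖ξ(z₀) − Ad_{hol_W(∂p)}ξ(z₀)‖ ≤ E_G` — the allowance of the repaired letter (memo §3) cannot be smaller than the
background's plaquette commutators on the residual gauge modes of `S`. [folklore] -/
theorem twoTerm_allowance_ge [Nonempty n] {L N : ℕ} [NeZero N] (hL : 1 ≤ L) (j : ℕ)
    {W : Site d → Fin d → (Matrix n n ℂ)ˣ} {x : ℝ} (hWu : IsUnitaryCfg W) (hWP : IsPeriodicCfg W ((N * L ^ (j + 1) : ℕ) : ℤ))
    (hx : 0 ≤ x) (hs : LevelSmall d L j x) (hWx : SmallField W x)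
    (hcritAll : ∀ Y : Site d → Fin d → Matrix n n ℂ, IsSkewDir Y → IsPeriodicDir Y ((N * L ^ (j + 1) : ℕ) : ℤ) →
      dAction W Y (perWin d (N * L ^ (j + 1))) = 0)
    {ξ : Site d → Matrix n n ℂ} (hξs : ∀ y, ξ y ∈ skewAdjoint (Matrix n n ℂ))
    (hξP : ∀ (y : Site d) (i : Fin d), ξ (y + ((N * L ^ (j + 1) : ℕ) : ℤ) • e i) = ξ y)
    (hξsp : ∀ (y : Site d) (κ : Fin d), ξ y = 0 ∨ ξ (y + e κ) = 0)
    (hξc : ∀ y : Site d, ξ (((L : ℤ) ^ (j + 1)) • y) = 0)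
    (z₀ : Site d) {μ₀ ν₀ : Fin d} (hμν : μ₀ ≠ ν₀)
    (S : Set (Site d → Fin d → Matrix n n ℂ))
    (hS : ∀ X : Site d → Fin d → Matrix n n ℂ, IsSkewDir X → IsPeriodicDir X ((N * L ^ (j + 1) : ℕ) : ℤ) → dirIter L (j + 1) W X = 0 → X ∈ S)
    {KG EG : ℝ}
    (hG2 : ∀ X ∈ S, IsPeriodicDir X ((N * L ^ (j + 1) : ℕ) : ℤ) → dirIter L (j + 1) W X = 0 → ∀ g : ℝ, 0 ≤ g →
      (∀ Y : Site d → Fin d → Matrix n n ℂ, IsSkewDir Y → IsPeriodicDir Y ((N * L ^ (j + 1) : ℕ) : ℤ) → dirIter L (j + 1) W Y = 0 →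
        |hess W X Y (perWin d (N * L ^ (j + 1)))| ≤ g * dirL1 Y (periodBox (d := d) (N * L ^ (j + 1)))) →
      ∀ z μ' ν', μ' ≠ ν' → ‖curlAt W X z μ' ν'‖ ≤ KG * g + EG) :
    ‖ξ z₀ - Ad (hol W z₀ (plaqWord μ₀ ν₀)) (ξ z₀)‖ ≤ EG := by
  set X : Site d → Fin d → Matrix n n ℂ := gaugeDir W ξ with hX
  have hXs : IsSkewDir X := isSkewDir_gaugeDir hWu hξs
  have hXP : IsPeriodicDir X ((N * L ^ (j + 1) : ℕ) : ℤ) := isPeriodicDir_gaugeDir hWP hξP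
  have hXT : dirIter L (j + 1) W X = 0 := dirIter_gaugeDir_eq_zero_of_vanish_corners hL j hWu hWP hx hs hWx hξs hξP hξc
  have h0 : ∀ Y : Site d → Fin d → Matrix n n ℂ, IsSkewDir Y → IsPeriodicDir Y ((N * L ^ (j + 1) : ℕ) : ℤ) → dirIter L (j + 1) W Y = 0 →
      |hess W X Y (perWin d (N * L ^ (j + 1)))| ≤ 0 * dirL1 Y (periodBox (d := d) (N * L ^ (j + 1))) := by
    intro Y hY hYP _
    rw [hX, hess_gaugeDir_left_eq_zero_of_critical W hcritAll hξs hξP hξsp hY hYP, abs_zero, zero_mul]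
  have hc := hG2 X (hS X hXs hXP hXT) hXP hXT 0 le_rfl h0 z₀ μ₀ ν₀ hμν
  rw [mul_zero, zero_add, hX, curlAt_gaugeDir] at hc
  exact hc

end

end Summit.QuantumFields.BalabanUV.T4Continuum.NE7SliceLetterGaugeObstruction
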